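import Mathlib
import Literature.NumberTheory.LFunctions.ConreyIwaniec2002
import Literature.NumberTheory.LFunctions.SubnormalZetaGapsLOneLowerBound

/-!
# Low-lying close pairs of zeros in the family of Dirichlet L-functions of modulus q ∈ [Q, 2Q]
(the SHAPE of Conrey–Iwaniec–Soundararajan 2012, Thm. 2.1, d = 1; cell ls-idea, census row R-19,
cards K-I3-2 / K-I1-1 / K4-4 «family zero spacing»)

Topic `Literature/NumberTheory/LFunctions`. PREDICATES with parameters + finite counting objects;
NOTHING IS ASSERTED. Conrey–Iwaniec 2002 print the «close critical zeros ⇒ effective L(1,χ) bound»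
criterion for `ζ` (Thm 1.2; tree `SubnormalGapsHypothesis c`, `conreyIwaniec2002_theorem12`) and
for class-group L-functions (Thm 1.1/Cor 1.3; `conreyIwaniec2002_theorem11/corollary13`).
Conrey–Iwaniec–Soundararajan 2012 [ConreyIwaniecSoundararajan2012] prove, ON GRH for the twists,
that for all large `Q` SOME primitive `χ` of modulus `q ∈ [Q,2Q]` has two zeros `½+iγ, ½+iγ′`,
`|γ|,|γ′| ≤ 1`, with `|γ − γ′| < (μ₁+ε)·2π/log Q`, `μ₁ = 0.366 < ½` (Thm 2.1 at d = 1), and say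
«loosely speaking, if one could prove that any L-function has a sufficient number of consecutive
zeros whose spacing is smaller than 1/2 of what is expected, then one could disprove the existence
of the Landau–Siegel zero [see CI]» (p. 3). This file types the OBJECTS of that sentence for the
Dirichlet family — a low close pair (critical-line form and critical-strip form), the per-modulus
and dyadic FAMILY counts, the density statement `FamilySubHalfGaps μ dens` with the density an
explicit PARAMETER (print fixes none: CIS give existence = density `Q⁻²`, the criterion would need a
negative power of `log Q`), and the conclusion SHAPE of CIS Thm 2.1 — so that census/idea rows can
cite decls. The unprinted family CRITERION «FamilySubHalfGaps ⇒ L(1,χ) ≫» is deliberately NOT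
stated here (it is an idea object, not literature). «The programme SEARCHES and TYPES; no claim
about Landau–Siegel zeros, Theorems 1–2 of arXiv:2211.02515 or a repaired Margin232 until a kernel
theorem says so.»

## References
* [ConreyIwaniecSoundararajan2012] J. B. Conrey, H. Iwaniec, K. Soundararajan, *Small gaps between
  zeros of twisted L-functions*, Acta Arith. 155 (2012) 353–371 = arXiv:1202.2671: §1 p. 3
  (criterion sentence, the two GRH uses), Thm. 2.1, p. 4 (μ₁ = 0.366, μ₂ = 0.519, μ₃ = 0.611).
  [held: paper:arxiv-1202.2671 p0003–p0004]
* [ConreyIwaniec2002] J. B. Conrey, H. Iwaniec, Acta Arith. 103 (2002) = arXiv:math/0111012,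
  Thm. 1.2 (1.22), §1 (1.19). [held: paper:arxiv-math_0111012 p0003]
-/

noncomputable section

open Complex Finset

namespace Literature.NumberTheory.LFunctions

namespace DirichletFamilyZeroSpacing

/-- **A low-lying close pair of CRITICAL zeros of `L(s,χ)`**: ordinates `γ ≠ γ'` in `[−1, 1]` with
`L(½+iγ, χ) = L(½+iγ', χ) = 0` and `|γ − γ'| ≤ r` (CIS 2012 Thm 2.1 shape: «zeros ½+iγ, ½+iγ′ of
L_f(s,χ) with |γ|,|γ′| ≤ 1»; compare `ConreyIwaniec2002.HasCloseZero` for one function up to height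
`T`). [cite: ConreyIwaniecSoundararajan2012, Thm. 2.1 (shape, d = 1)] -/
def HasLowClosePair {q : ℕ} [NeZero q] (χ : DirichletCharacter ℂ q) (r : ℝ) : Prop :=
  ∃ γ γ' : ℝ, |γ| ≤ 1 ∧ |γ'| ≤ 1 ∧ γ ≠ γ' ∧ |γ - γ'| ≤ r ∧
    χ.LFunction (1 / 2 + γ * I) = 0 ∧ χ.LFunction (1 / 2 + γ' * I) = 0

/-- **A low-lying close pair of zeros of `L(s,χ)` in the critical STRIP** (zeros off the line
allowed, as Conrey–Iwaniec's consumer permits, CI 2002 p. 3 L41–L47): `ρ ≠ ρ'` with `0 < re < 1`,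
`|im| ≤ 1`, `L(ρ,χ) = L(ρ',χ) = 0`, `‖ρ − ρ'‖ ≤ r`.
[cite: ConreyIwaniec2002, §1 p. 3 (zeros off the line allowed)] -/
def HasLowClosePairStrip {q : ℕ} [NeZero q] (χ : DirichletCharacter ℂ q) (r : ℝ) : Prop :=
  ∃ ρ ρ' : ℂ, 0 < ρ.re ∧ ρ.re < 1 ∧ 0 < ρ'.re ∧ ρ'.re < 1 ∧ |ρ.im| ≤ 1 ∧ |ρ'.im| ≤ 1 ∧
    ρ ≠ ρ' ∧ ‖ρ - ρ'‖ ≤ r ∧ χ.LFunction ρ = 0 ∧ χ.LFunction ρ' = 0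

/-- A critical close pair is a strip close pair. [cite: ConreyIwaniec2002, §1 p. 3] -/
theorem HasLowClosePair.strip {q : ℕ} [NeZero q] {χ : DirichletCharacter ℂ q} {r : ℝ}
    (h : HasLowClosePair χ r) : HasLowClosePairStrip χ r := by
  obtain ⟨γ, γ', hγ, hγ', hne, hr, hz, hz'⟩ := h
  refine ⟨1 / 2 + γ * I, 1 / 2 + γ' * I, ?_, ?_, ?_, ?_, ?_, ?_, ?_, ?_, hz, hz'⟩
  · simp
  · simp; norm_num
  · simp
  · simp; norm_num
  · simpa using hγ
  · simpa using hγ'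
  · intro h
    apply hne
    have := congrArg Complex.im h
    simpa using this
  · have : (1 / 2 + γ * I) - (1 / 2 + γ' * I) = ((γ - γ' : ℝ) : ℂ) * I := by push_cast; ring
    rw [this, norm_mul, Complex.norm_I, mul_one, Complex.norm_real, Real.norm_eq_abs]
    exact hr

/-- The sub-mean radius `μ · 2π/log Q`: the mean spacing of the low-lying zeros of `L(s,χ)`,
`q ~ Q`, is `≍ 2π/log Q`; `μ < ½` is «smaller than 1/2 of what is expected».
[cite: ConreyIwaniecSoundararajan2012, Thm. 2.1 (the factor 2π/(d log Q), d = 1)] -/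
def familyGapRadius (μ Q : ℝ) : ℝ :=
  μ * (2 * Real.pi / Real.log Q)

open Classical in
/-- Number of PRIMITIVE characters `χ mod q` with a low close pair of critical zeros at radius
`familyGapRadius μ Q` (junk `0` at `q = 0`). [cite: ConreyIwaniecSoundararajan2012, Thm. 2.1 (shape)] -/
def closePairCharCount (μ Q : ℝ) (q : ℕ) : ℕ :=
  if hq : q = 0 then 0 else
    haveI : NeZero q := ⟨hq⟩
    (Finset.univ.filter fun χ : DirichletCharacter ℂ q =>
      χ.IsPrimitive ∧ HasLowClosePair χ (familyGapRadius μ Q)).card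

/-- The dyadic FAMILY count `Σ_{Q ≤ q ≤ 2Q} #{χ mod q primitive with a low close critical pair at
radius μ·2π/log Q}` (family of all primitive Dirichlet characters of modulus `q ∈ [Q, 2Q]`, size
`≍ Q²`). [cite: ConreyIwaniecSoundararajan2012, Thm. 2.1 (shape)] -/
def familyClosePairCount (μ : ℝ) (Q : ℕ) : ℕ :=
  ∑ q ∈ Finset.Icc Q (2 * Q), closePairCharCount μ Q q

/-- **FAMILY SUB-HALF GAPS with density `dens` (parametric X of census row R-19).** For all large
`Q`, at least `dens(Q) · Q²` pairs (`q ∈ [Q,2Q]`, primitive `χ mod q`) carry a low-lying close pair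
of critical zeros at radius `μ · 2π/log Q`. Interesting regime: `μ < ½`, `dens` a negative power of
`log Q` (CI's ζ-criterion counts `(log T)^{−1/5}` of all zeros). PRINT FIXES NO `dens` — a
PREDICATE with parameters, never asserted. [cite: ConreyIwaniecSoundararajan2012, §1 p. 3 («loosely speaking …»)] -/
def FamilySubHalfGaps (μ : ℝ) (dens : ℝ → ℝ) : Prop :=
  ∃ Q₀ : ℕ, ∀ Q : ℕ, Q₀ ≤ Q → dens Q * (Q : ℝ) ^ 2 ≤ (familyClosePairCount μ Q : ℝ)

/-- **SHAPE of CIS 2012 Thm 2.1's conclusion (d = 1)**: for every `ε > 0` and all large `Q`, SOME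
primitive `χ` of modulus `q ∈ [Q,2Q]` has a low close critical pair at radius `(μ+ε)·2π/log Q`.
Print proves this with `μ = μ₁ = 0.366` UNDER GRH for the twists; the GRH hypothesis is not typed
here (conclusion shape only; never asserted unconditionally).
[cite: ConreyIwaniecSoundararajan2012, Thm. 2.1 with μ₁ = 0.366 (p. 4)] -/
def CISClosePairEventually (μ : ℝ) : Prop :=
  ∀ ε : ℝ, 0 < ε → ∃ Q₀ : ℕ, ∀ Q : ℕ, Q₀ ≤ Q → 1 ≤ familyClosePairCount (μ + ε) Q

/-- Bookkeeping (proved): ONE close pair per dyadic range is exactly `FamilySubHalfGaps` with the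
degenerate density `Q ↦ Q⁻²` — what separates CIS 2012 (GRH, existence) from a CI-type criterion
is the DENSITY, made explicit. [cite: ConreyIwaniecSoundararajan2012, Thm. 2.1] -/
theorem familySubHalfGaps_inv_sq_iff (μ : ℝ) :
    FamilySubHalfGaps μ (fun Q => (Q ^ 2)⁻¹) ↔
      ∃ Q₀ : ℕ, ∀ Q : ℕ, Q₀ ≤ Q → Q ≠ 0 → 1 ≤ familyClosePairCount μ Q := by
  constructor
  · rintro ⟨Q₀, h⟩
    refine ⟨Q₀, fun Q hQ hQ0 => ?_⟩
    have hQ' : (0 : ℝ) < (Q : ℝ) ^ 2 := by positivity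
    have := h Q hQ
    rw [inv_mul_cancel₀ hQ'.ne'] at this
    exact_mod_cast this
  · rintro ⟨Q₀, h⟩
    refine ⟨max Q₀ 1, fun Q hQ => ?_⟩
    have hQ0 : Q ≠ 0 := by
      have : 1 ≤ Q := le_trans (le_max_right _ _) hQ
      omega
    have hQ' : (0 : ℝ) < (Q : ℝ) ^ 2 := by positivity
    rw [inv_mul_cancel₀ hQ'.ne']
    exact_mod_cast h Q (le_trans (le_max_left _ _) hQ) hQ0

/-- Monotonicity (proved): a close pair at radius `r` is a close pair at any larger radius.
[cite: ConreyIwaniecSoundararajan2012, Thm. 2.1 (shape)] -/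
theorem HasLowClosePair.mono {q : ℕ} [NeZero q] {χ : DirichletCharacter ℂ q} {r r' : ℝ}
    (hrr' : r ≤ r') (h : HasLowClosePair χ r) : HasLowClosePair χ r' := by
  obtain ⟨γ, γ', hγ, hγ', hne, hr, hz, hz'⟩ := h
  exact ⟨γ, γ', hγ, hγ', hne, hr.trans hrr', hz, hz'⟩

end DirichletFamilyZeroSpacing

end Literature.NumberTheory.LFunctions
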